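import Mathlib
import HarnessLib
import Summits.KontsevichZagierPeriods.Zeta5Search.TwoTaleSecondTaleLineRep
import Summits.KontsevichZagierPeriods.Zeta5Search.TwoTaleRungALineBoundRate
import Summits.KontsevichZagierPeriods.Zeta5Search.TwoTaleLineBoundRCT
import Summits.KontsevichZagierPeriods.Zeta5Search.TwoTaleP15SecondTale

/-!
# Second tale at P15's partner `(32,11,13,15 | 15,6,24,26)·n`: the scaled line bound for `R̂ₙ`

HONEST FRAMING: systematic search; no irrationality claim unless certified.  Cell pub-zeta5, class `measure`
(fam-measure g5, task U2 of RULING R3′), T3/T4.  No measure or irrationality claim is made here, and the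
design value `DecayT 29.108` stays "formalisation pending" until the whole chain lands.

This is the tale-2 clone of `TwoTaleRungALineRate` (p253876): an explicit **one-variable rate function**
`rateT` and the bound, for `n ≥ 1`, `η ≠ 0`, on the saddle line `Re t = wₙ := −9n − ¾ + ⌊3n/50⌋/2` of the
`t`-plane (design abscissa `ξ = −897/100 = −8.97`, the line of P1 g10's one-variable certificate
`TwoTaleP15SecondLineProfileShape`; the image of the `u`-line `Re u = 8n + ⌊3n/50⌋ + ½`, `u = 2t + â₀*`,
`â₀* = 26n+2`, of `TwoTaleSecondTaleStripShift`; the `O(1)` offset is absorbed by the Lipschitz transfer):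

  `log ‖R̂ₙ(wₙ + i·nη)‖ ≤ n·rateT η + 8·log(19² + (2η)²) + constLineT`,

where `R̂ₙ = RCT (aT n) (bT n)` is Zudilin's second-tale rational function [Zudilin2014ZetaTwo, (25)]
`normT · ∏_{l∈[15n+2,32n+2)}(2t+l) · ∏_{[6n+1,11n+1)}(t+i) / (∏_{[13n+1,24n+2)}(t+i) · ∏_{[15n+1,26n+2)}(t+i))`.
Ingredients (all PROVED, P1 g8–g10): block sums against `prim` (`sum_halfLog_le`, `le_sum_halfLog`), the scaling
law of `prim`, the Lipschitz endpoint transfer `prim_endpoint_gen` (window `½ ≤ |W| ≤ 19`), two-sided Stirling for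
`normT = (11n)!²/((17n)!(5n)!)` (`κ_T = 22 log 11 − 17 log 17 − 5 log 5`); the doubled block lives at height `2y`.
* inputs by name: the tree's `TwoTaleLineBoundRCT.log_norm_RCT_eq/_le` (P1 g10; general `(a,b)`, closed form in `prim`/`halfLog`);
  here: `rateT`, `kappaT`, `constLineT`, `wLineT`; `log_normT_T_le`; **`log_norm_RCT_T_line_le`**.
Numerically `sup_η (rateT η − 2π|η|) = −29.1078672` at `η ≈ ±1.2915` (in-seat float cross-check, = P1 g10's
design sup; model optimum over the abscissa `−29.1078713` at `−8.972`); `rateT η = profileT0 (−897/100) η`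
(`η ≠ 0`, P1's `gPrim` normal form) is proved downstream, and the interval certificate is P1 g10's file.
References: W. Zudilin, arXiv:1310.1526 [Zudilin2014ZetaTwo] §6, (25), Prop. 3.
-/

noncomputable section

open Real Complex Finset Polynomial
open Literature.NumberTheory.Irrationality.Zudilin2014
open Summit.KontsevichZagierPeriods.Zeta5Search.TwoTaleLineBound
open Summit.KontsevichZagierPeriods.Zeta5Search.TwoTaleSecondTaleLineRep
open Summit.KontsevichZagierPeriods.Zeta5Search.TwoTaleP15 (aT bT aT_zero aT_one aT_two aT_three bT_zero bT_one
  bT_two bT_three)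

namespace Summit.KontsevichZagierPeriods.Zeta5Search.TwoTaleSecondTaleLineRate

variable {y η : ℝ}

/-! ### `log ‖R̂(a,b; u+iy)‖`: the tree's closed form (`TwoTaleLineBoundRCT.log_norm_RCT_eq/_le`, P1 g10) is used by name -/

/-- `normT a b > 0` (a ratio of factorials). -/
theorem normT_pos (a b : Fin 4 → ℤ) : 0 < normT a b := by
  unfold normT facZ; positivity

/-! ### The partner's data -/

/-- The saddle line `Re t = wₙ := −9n − ¾ + ⌊3n/50⌋/2` (image of `Re u = 8n + ⌊3n/50⌋ + ½`; `wₙ/n → −897/100`,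
P1 g10's certificate abscissa; model optimum `−8.972`). -/
def wLineT (n : ℕ) : ℝ := -(9 * (n : ℝ)) - 3 / 4 + ((3 * n / 50 : ℕ) : ℝ) / 2

/-- The entropy row of `normT = (11n)!²/((17n)!(5n)!)`: `κ_T = 22 log 11 − 17 log 17 − 5 log 5 ≈ −3.45903`. -/
def kappaT : ℝ := 22 * Real.log 11 - 17 * Real.log 17 - 5 * Real.log 5

/-- **The tale-2 rate function at `ξ = −897/100`** (doubled block at height `2η`, legs `2ξ+32 = 703/50`,
`2ξ+15 = −147/50`; `t+i` blocks: numerator legs `ξ+11 = 203/100`, `ξ+6 = −297/100`, denominator legs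
`ξ+24 = 1503/100 | ξ+13 = 403/100` and `ξ+26 = 1703/100 | ξ+15 = 603/100`): `Σ± prim + κ_T`. -/
def rateT (η : ℝ) : ℝ :=
  (prim (2 * η) (703 / 50) - prim (2 * η) (-147 / 50)) + (prim η (203 / 100) - prim η (-297 / 100))
    - (prim η (1503 / 100) - prim η (403 / 100)) - (prim η (1703 / 100) - prim η (603 / 100)) + kappaT

/-- The additive constant of the line bound. -/
def constLineT : ℝ := 12 * |Real.log (1 / 2)| + 2 * (1 + Real.log 2) + 3

/-- `normT` at the partner: `(11n)!²/((17n)!(5n)!)`. -/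
theorem normT_T (n : ℕ) : normT (aT n) (bT n) =
    ((11 * n).factorial : ℚ) ^ 2 / (((17 * n).factorial : ℚ) * ((5 * n).factorial : ℚ)) := by
  have e2 : (bT n 2 - aT n 2 - 1).toNat = 11 * n := by rw [aT_two, bT_two]; omega
  have e3 : (bT n 3 - aT n 3 - 1).toNat = 11 * n := by rw [aT_three, bT_three]; omega
  have e0 : (aT n 0 - bT n 0).toNat = 17 * n := by rw [aT_zero, bT_zero]; omega
  have e1 : (aT n 1 - bT n 1).toNat = 5 * n := by rw [aT_one, bT_one]; omega
  unfold normT facZ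
  rw [e2, e3, e0, e1]
  ring

/-- `log normT` at the partner as factorial logs. -/
theorem log_normT_T (n : ℕ) : Real.log (normT (aT n) (bT n) : ℝ) =
    2 * Real.log ((11 * n).factorial : ℝ) - Real.log ((17 * n).factorial : ℝ) - Real.log ((5 * n).factorial : ℝ) := by
  rw [normT_T]
  push_cast
  have h : ∀ k : ℕ, (0 : ℝ) < (k.factorial : ℝ) := fun k => by exact_mod_cast Nat.factorial_pos k
  rw [Real.log_div (pow_ne_zero _ (h _).ne') (mul_ne_zero (h _).ne' (h _).ne'), Real.log_mul (h _).ne' (h _).ne',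
    Real.log_pow]
  push_cast
  ring

/-- **Stirling for `normT`** (`n ≥ 1`): `log normT ≤ n·κ_T + 3` (the `n log n` and `n` rows cancel). -/
theorem log_normT_T_le {n : ℕ} (hn : 1 ≤ n) : Real.log (normT (aT n) (bT n) : ℝ) ≤ n * kappaT + 3 := by
  have hn0 : (0 : ℝ) < n := by exact_mod_cast hn
  rw [log_normT_T]
  have c11 : Real.log ((11 * n : ℕ) : ℝ) = Real.log 11 + Real.log n := by
    push_cast; exact Real.log_mul (by norm_num) hn0.ne'
  have c17 : Real.log ((17 * n : ℕ) : ℝ) = Real.log 17 + Real.log n := by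
    push_cast; exact Real.log_mul (by norm_num) hn0.ne'
  have c5 : Real.log ((5 * n : ℕ) : ℝ) = Real.log 5 + Real.log n := by
    push_cast; exact Real.log_mul (by norm_num) hn0.ne'
  have s11 := (log_factorial_two_sided (n := 11 * n) (by omega)).2
  have s17 := (log_factorial_two_sided (n := 17 * n) (by omega)).1
  have s5 := (log_factorial_two_sided (n := 5 * n) (by omega)).1
  rw [c11] at s11; rw [c17] at s17; rw [c5] at s5
  simp only [Nat.cast_mul, Nat.cast_ofNat] at s11 s17 s5
  have q11 : (11 * (n : ℝ)) * (Real.log 11 + Real.log n) = 11 * (n * Real.log 11) + 11 * (n * Real.log n) := by ring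
  have q17 : (17 * (n : ℝ)) * (Real.log 17 + Real.log n) = 17 * (n * Real.log 17) + 17 * (n * Real.log n) := by ring
  have q5 : (5 * (n : ℝ)) * (Real.log 5 + Real.log n) = 5 * (n * Real.log 5) + 5 * (n * Real.log n) := by ring
  have hκ : (n : ℝ) * kappaT = 22 * (n * Real.log 11) - 17 * (n * Real.log 17) - 5 * (n * Real.log 5) := by
    unfold kappaT; ring
  have hlog1117 : Real.log 11 ≤ Real.log 17 := Real.log_le_log (by norm_num) (by norm_num)
  have hlog115 : Real.log 11 - Real.log 5 ≤ 11 / 5 - 1 := by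
    rw [← Real.log_div (by norm_num) (by norm_num)]
    exact Real.log_le_sub_one_of_pos (by norm_num)
  rw [hκ]
  linarith

/-! ### The line bound -/

set_option maxHeartbeats 400000 in
/-- **The scaled line bound for the second tale**: for `n ≥ 1`, `η ≠ 0`,
`log ‖RCT (aT n) (bT n) (wₙ + i·nη)‖ ≤ n·rateT η + 8 log(19² + (2η)²) + constLineT`. -/
theorem log_norm_RCT_T_line_le (hη : η ≠ 0) {n : ℕ} (hn : 1 ≤ n) :
    Real.log ‖RCT (aT n) (bT n) ((wLineT n : ℂ) + (((n : ℝ) * η : ℝ) : ℂ) * I)‖ ≤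
      n * rateT η + 8 * Real.log (19 ^ 2 + (2 * η) ^ 2) + constLineT := by
  have hn0 : (0 : ℝ) < n := by exact_mod_cast hn
  have hn1 : (1 : ℝ) ≤ n := by exact_mod_cast hn
  have hy : (n : ℝ) * η ≠ 0 := mul_ne_zero hn0.ne' hη
  have hη2 : 2 * η ≠ 0 := mul_ne_zero two_ne_zero hη
  have hsq : (19 : ℝ) ^ 2 + η ^ 2 ≤ 19 ^ 2 + (2 * η) ^ 2 := by nlinarith [sq_nonneg η]
  have hlog12 : Real.log (19 ^ 2 + η ^ 2) / 2 ≤ Real.log (19 ^ 2 + (2 * η) ^ 2) / 2 :=  -- `/2`: linarith normal form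
    div_le_div_of_nonneg_right (Real.log_le_log (by positivity) hsq) (by norm_num)
  have h32 : (3 : ℝ) / (2 * n) ≤ 3 / 2 := div_le_div_of_nonneg_left (by norm_num) (by norm_num) (by linarith only [hn1])
  have a1 : 1 / 2 + 3 / (2 * (n : ℝ)) ≤ |(703 / 50 : ℝ)| ∧ |(703 / 50 : ℝ)| + 3 / 2 ≤ 19 := by
    rw [abs_of_pos (by norm_num)]; constructor <;> linarith only [h32]
  have a2 : 1 / 2 + 3 / (2 * (n : ℝ)) ≤ |(-147 / 50 : ℝ)| ∧ |(-147 / 50 : ℝ)| + 3 / 2 ≤ 19 := by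
    rw [abs_of_neg (by norm_num)]; constructor <;> linarith only [h32]
  have a3 : 1 / 2 + 3 / (2 * (n : ℝ)) ≤ |(203 / 100 : ℝ)| ∧ |(203 / 100 : ℝ)| + 3 / 2 ≤ 19 := by
    rw [abs_of_pos (by norm_num)]; constructor <;> linarith only [h32]
  have a4 : 1 / 2 + 3 / (2 * (n : ℝ)) ≤ |(-297 / 100 : ℝ)| ∧ |(-297 / 100 : ℝ)| + 3 / 2 ≤ 19 := by
    rw [abs_of_neg (by norm_num)]; constructor <;> linarith only [h32]
  have a5 : 1 / 2 + 3 / (2 * (n : ℝ)) ≤ |(1503 / 100 : ℝ)| ∧ |(1503 / 100 : ℝ)| + 3 / 2 ≤ 19 := by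
    rw [abs_of_pos (by norm_num)]; constructor <;> linarith only [h32]
  have a6 : 1 / 2 + 3 / (2 * (n : ℝ)) ≤ |(403 / 100 : ℝ)| ∧ |(403 / 100 : ℝ)| + 3 / 2 ≤ 19 := by
    rw [abs_of_pos (by norm_num)]; constructor <;> linarith only [h32]
  have a7 : 1 / 2 + 3 / (2 * (n : ℝ)) ≤ |(1703 / 100 : ℝ)| ∧ |(1703 / 100 : ℝ)| + 3 / 2 ≤ 19 := by
    rw [abs_of_pos (by norm_num)]; constructor <;> linarith only [h32]
  have a8 : 1 / 2 + 3 / (2 * (n : ℝ)) ≤ |(603 / 100 : ℝ)| ∧ |(603 / 100 : ℝ)| + 3 / 2 ≤ 19 := by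
    rw [abs_of_pos (by norm_num)]; constructor <;> linarith only [h32]
  obtain ⟨hm, hM, hM0⟩ : (0 : ℝ) < 1 / 2 ∧ (1 : ℝ) ≤ 19 ∧ (0 : ℝ) ≤ 19 := by norm_num
  set w : ℝ := wLineT n with hw
  have hwdef : w = -(9 * (n : ℝ)) - 3 / 4 + ((3 * n / 50 : ℕ) : ℝ) / 2 := rfl
  have hj0 : (0 : ℝ) ≤ ((3 * n / 50 : ℕ) : ℝ) := Nat.cast_nonneg _
  have hj1 : (50 : ℝ) * ((3 * n / 50 : ℕ) : ℝ) ≤ 3 * n := by exact_mod_cast Nat.mul_div_le (3 * n) 50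
  have hj2 : 3 * (n : ℝ) < 50 * ((3 * n / 50 : ℕ) : ℝ) + 50 := by
    exact_mod_cast (by omega : 3 * n < 50 * (3 * n / 50) + 50)
  obtain ⟨e1a, e1b⟩ := abs_le.1 (prim_endpoint_gen hη2 hn hm hM (E := 2 * w + (32 * n + 1)) (Vs := 703 / 50)
    (by rw [abs_le]; constructor <;> linarith only [hwdef, hj1, hj2]) a1.1 a1.2)
  obtain ⟨e2a, e2b⟩ := abs_le.1 (prim_endpoint_gen hη2 hn hm hM (E := 2 * w + (15 * n + 2)) (Vs := -147 / 50)
    (by rw [abs_le]; constructor <;> linarith only [hwdef, hj1, hj2]) a2.1 a2.2)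
  obtain ⟨e3a, e3b⟩ := abs_le.1 (prim_endpoint_gen hη hn hm hM (E := w + 11 * n) (Vs := 203 / 100)
    (by rw [abs_le]; constructor <;> linarith only [hwdef, hj1, hj2]) a3.1 a3.2)
  obtain ⟨e4a, e4b⟩ := abs_le.1 (prim_endpoint_gen hη hn hm hM (E := w + (6 * n + 1)) (Vs := -297 / 100)
    (by rw [abs_le]; constructor <;> linarith only [hwdef, hj1, hj2]) a4.1 a4.2)
  obtain ⟨e5a, e5b⟩ := abs_le.1 (prim_endpoint_gen hη hn hm hM (E := w + (24 * n + 1)) (Vs := 1503 / 100)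
    (by rw [abs_le]; constructor <;> linarith only [hwdef, hj1, hj2]) a5.1 a5.2)
  obtain ⟨e6a, e6b⟩ := abs_le.1 (prim_endpoint_gen hη hn hm hM (E := w + (13 * n + 1) - 1) (Vs := 403 / 100)
    (by rw [abs_le]; constructor <;> linarith only [hwdef, hj1, hj2]) a6.1 a6.2)
  obtain ⟨e7a, e7b⟩ := abs_le.1 (prim_endpoint_gen hη hn hm hM (E := w + (26 * n + 1)) (Vs := 1703 / 100)
    (by rw [abs_le]; constructor <;> linarith only [hwdef, hj1, hj2]) a7.1 a7.2)
  obtain ⟨e8a, e8b⟩ := abs_le.1 (prim_endpoint_gen hη hn hm hM (E := w + (15 * n + 1) - 1) (Vs := 603 / 100)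
    (by rw [abs_le]; constructor <;> linarith only [hwdef, hj1, hj2]) a8.1 a8.2)
  have l1 := halfLog_endpoint_gen hη2 hn hM0 (E := 2 * w + (15 * n + 2))
    (by rw [abs_le]; constructor <;> linarith only [hwdef, hn1, hj0, hj1])
  have l2 := halfLog_endpoint_gen hη2 hn hM0 (E := 2 * w + (32 * n + 1))
    (by rw [abs_le]; constructor <;> linarith only [hwdef, hn1, hj0, hj1])
  have l3 := halfLog_endpoint_gen hη hn hM0 (E := w + (6 * n + 1))
    (by rw [abs_le]; constructor <;> linarith only [hwdef, hn1, hj0, hj1])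
  have l4 := halfLog_endpoint_gen hη hn hM0 (E := w + 11 * n)
    (by rw [abs_le]; constructor <;> linarith only [hwdef, hn1, hj0, hj1])
  have hG : (n : ℝ) * rateT η = n * prim (2 * η) (703 / 50) - n * prim (2 * η) (-147 / 50)
      + (n * prim η (203 / 100) - n * prim η (-297 / 100)) - (n * prim η (1503 / 100) - n * prim η (403 / 100))
      - (n * prim η (1703 / 100) - n * prim η (603 / 100)) + n * kappaT := by
    unfold rateT; ring
  have h0 : bT n 0 + 2 ≤ aT n 0 := by rw [aT_zero, bT_zero]; omega
  have h1 : bT n 1 + 2 ≤ aT n 1 := by rw [aT_one, bT_one]; omega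
  have h2 : aT n 2 < bT n 2 := by rw [aT_two, bT_two]; omega
  have h3 : aT n 3 < bT n 3 := by rw [aT_three, bT_three]; omega
  have c2a : ((aT n 2 : ℤ) : ℝ) = 13 * n + 1 := by rw [aT_two]; push_cast; ring
  have c3a : ((aT n 3 : ℤ) : ℝ) = 15 * n + 1 := by rw [aT_three]; push_cast; ring
  have hw2 : 1 ≤ w + ((aT n 2 : ℤ) : ℝ) := by rw [c2a]; linarith only [hwdef, hn1, hj0]
  have hw3 : 1 ≤ w + ((aT n 3 : ℤ) : ℝ) := by rw [c3a]; linarith only [hwdef, hn1, hj0]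
  have hB := log_norm_RCT_le hy h0 h1 h2 h3 hw2 hw3
  rw [abs_of_pos (show (0 : ℝ) < (normT (aT n) (bT n) : ℝ) by exact_mod_cast normT_pos (aT n) (bT n))] at hB
  have c0 : ((aT n 0 - 1 : ℤ) : ℝ) = 32 * n + 1 := by rw [aT_zero]; push_cast; ring
  have c0b : ((bT n 0 : ℤ) : ℝ) = 15 * n + 2 := by rw [bT_zero]; push_cast; ring
  have c1 : ((aT n 1 - 1 : ℤ) : ℝ) = 11 * n := by rw [aT_one]; push_cast; ring
  have c1b : ((bT n 1 : ℤ) : ℝ) = 6 * n + 1 := by rw [bT_one]; push_cast; ring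
  have c2 : ((bT n 2 - 1 : ℤ) : ℝ) = 24 * n + 1 := by rw [bT_two]; push_cast; ring
  have c3 : ((bT n 3 - 1 : ℤ) : ℝ) = 26 * n + 1 := by rw [bT_three]; push_cast; ring
  rw [c0, c0b, c1, c1b, c2, c3, c2a, c3a, show (2 : ℝ) * ((n : ℝ) * η) = n * (2 * η) by ring] at hB
  rw [hG, constLineT]
  clear_value w
  refine hB.trans ?_
  linarith only [e1b, e2a, e3b, e4a, e5a, e6b, e7a, e8b, l1, l2, l3, l4, log_normT_T_le hn, hlog12]

end Summit.KontsevichZagierPeriods.Zeta5Search.TwoTaleSecondTaleLineRate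

end
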